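import Literature.NumberTheory.EllipticCurves.CasselsTateGeneralCase
import Literature.NumberTheory.EllipticCurves.SelmerTorsionCMOperatorJZero
import HarnessLib

/-!
# The general-case Cassels–Tate function is INVARIANT under a `K`-automorphism of the curve preserving the
# level-`m²` pairing: `⟨H¹(φ) a, H¹(φ) a'⟩ = ⟨a, a'⟩`; hence `⟨H¹(φ) a, b⟩ = ⟨a, H¹(φ⁻¹) b⟩` and `𝒪`-balance

Topic `NumberTheory/EllipticCurves`; namespace `Literature.NumberTheory.EllipticCurves`. THEOREMS ONLY: no
definition, no named fact, no instance, no notation (D-0026, net debt 0). Vocabulary: `CasselsTateGeneralCase(Local)`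
(Milne's data `GeneralCaseData`, its local terms, THE DEFINITION `ctGeneralFun W m e … inv a a'` of the general case of
the Cassels–Tate pairing at level `m` for a family `inv` of local invariant maps), `SelmerTorsionCMOperatorJZero`
(`H¹` of an equivariant endomorphism of `E[n]`: `torsionH1ToH1_resH1Hom_id`, `resH1Hom_id_mem_selmerGroup`),
`ShaIsogeny` (`galH1Map`, `shaMap`, `HasLocalPointsMaps`). Seat `bsd-cm-k-ty1` (eleventh seating), planner GO D602 (2)
((K-c)(T3)); helper of crux `stmt-BirchSwinnertonDyer-19804` (`UpperOffV0HSYPlus`). No summit statement is proved or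
advanced by this file alone; nothing about the order of `Ш` is asserted; BSD is not claimed.

## THE PRINT and THE ARGUMENT

Milne, *ADT* (2nd ed. 2006) I Rem. 6.10(a), p. 79 [held `paper:url-620c8c980f6e` p. 87 L36–41]: «if `f : A → B` is an
isogeny, then `⟨f(a), b⟩ = ⟨a, fᵗ(b)⟩` … This follows from the fact that the local pairings are functorial». For an
AUTOMORPHISM `φ` of `E` over `K` (`φᵗ = φ̂ = φ⁻¹`, degree `1`; Silverman *AEC* III.6.1–6.2) which preserves the
level-`m²` pairing `e` used to build the pairing (for the Weil pairing: III.8.2 with `deg φ = 1`), the functoriality is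
an honest TRANSPORT OF MILNE'S DATA (proof of Prop. 6.9, general case): the choices `(b, β, β₁, f, b', β', ε, κ_v)` for
`(a, a')` push forward along `F = φ|E[·]` to choices for `(H¹(φ) a, H¹(φ) a')` WITH THE SAME `ε` (because
`(F f) ∪_e (F β') = f ∪_e β'`) and the local `2`-cocycles `(β_{1,v} - κ_v) ∪_e β'_v - ε_v` agree pointwise, so every
local term — for EVERY family `inv` — is unchanged; transporting back along `φ⁻¹` gives the equality of the tree's
`ctGeneralFun` on the nose (both sides are `0` when no finitely supported data exist).

## WHAT IS FORMALISED

* §1–§3 (`CasselsTateInvariance.*`): `exists_torsionIntertwining` (`f|E[n]` as a `→ⁱL`),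
  `map_restrictField_mem_kummerLocalConditionAt` (the local Kummer conditions are stable under `H¹(F)`),
  ★ `exists_transport` (data for `(a, a')` ↦ data for `(H¹(f) a, H¹(f) a')` with the same local terms).
* §4 ★ `ctGeneralFun_galH1Map_galH1Map_of_inverse` / `…_of_isogeny_inverse` (INVARIANCE, all `a, a' ∈ H¹(K, E)`,
  every `inv` with the reciprocity law), ★ `ctGeneralFun_galH1Map_left_eq_galH1Map_right_of_isogeny_inverse` (clause
  (vi) of `casselsTate_canonical_adjoint` FOR AN INVERSE PAIR `ψ ∘ φ = id = φ ∘ ψ`, e.g. `[ζ], [ζ²]`, as a THEOREM),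
  ★ `pairing_omegaBalanced_of_weilInvariant` (`φ³ = id`, `w` under `Ш(φ)` with `w² + w + 1 = 0`, `B₂` factoring
  through `ctGeneralFun`: `B₂ (w a) (w b) = B₂ a b`, `B₂ (w a) b = B₂ a (w² b) = B₂ a (-b - w b)`).

Displayed inputs (never named facts): `halt` (`e` alternating), `hPT'` (reciprocity law of `inv`), and
`he : e (φ S) (φ T) = e S T` on `E[m²]` (for the Weil pairing and `[ζ]`: Silverman III.8.2 with `deg [ζ] = 1`).

## References

* [MilneADT2006] J. S. Milne, *Arithmetic Duality Theorems*, 2nd ed. (2006), Ch. I §6, Prop. 6.9 (proof, general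
  case), Remark 6.10(a).
* [SilvermanAEC2009] J. H. Silverman, *The Arithmetic of Elliptic Curves*, 2nd ed. (2009), III.6.1–6.2, III.8.2.
* [SerreGaloisCohomology1997] J.-P. Serre, *Galois Cohomology* (1997), I.§2.4. [McCallumLMS1991] W. G. McCallum,
  Kolyvagin's work on Shafarevich–Tate groups, LMS LN 153 (1991), §5.
-/

noncomputable section

open scoped Classical

universe u

namespace Literature.NumberTheory.EllipticCurves

open CategoryTheory _root_.WeierstrassCurve Field Function NumberField
open Literature.NumberTheory.GaloisRepresentations Literature.NumberTheory.GaloisCohomology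
open Literature.NumberTheory.GaloisRepresentations.DiscreteGaloisModule (mu MuCarrier pairing)
open scoped ContRepresentation

namespace CasselsTateInvariance

variable {K : Type u} [Field K] (W : WeierstrassCurve K) (m : ℕ)

/-! ## §1 The restriction of an equivariant endomorphism of `E(K̄)` to `E[n]` -/

/-- **An equivariant additive endomorphism `f` of `E(K̄)` restricts to a continuous `Γ_K`-intertwining
endomorphism of the discrete Galois module `E[n]`** (`f (E[n]) ⊆ E[n]` since `f` is additive).
Serre, *Galois Cohomology*, I.§2.4 (compatible pairs). [cite: SerreGaloisCohomology1997, I.§2.4] -/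
theorem exists_torsionIntertwining (f : W.geomPoints →+ W.geomPoints)
    (hf : ∀ (σ : absoluteGaloisGroup K) (P : W.geomPoints), f (σ • P) = σ • f P) (n : ℤ) :
    ∃ F : (W.torsionGaloisModule n).toContRepresentation →ⁱL (W.torsionGaloisModule n).toContRepresentation,
      ∀ S : geomTorsion W n, ((F S : geomTorsion W n) : W.geomPoints) = f S := by
  let g : geomTorsion W n →+ geomTorsion W n :=
    (f.comp (geomTorsion W n).subtype).codRestrict (geomTorsion W n) fun P => by
      simp only [AddMonoidHom.coe_comp, AddSubgroup.coe_subtype, Function.comp_apply]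
      rw [mem_geomTorsion_iff, ← map_zsmul, (mem_geomTorsion_iff _ n _).mp P.2, map_zero]
  refine ⟨{ toContinuousLinearMap := ⟨g.toIntLinearMap, continuous_of_discreteTopology⟩
            isIntertwining' := fun σ => ?_ }, fun _ => rfl⟩
  ext P
  change (f ((σ • P : geomTorsion W n) : W.geomPoints) : W.geomPoints) = σ • f (P : W.geomPoints)
  rw [AddSubgroup.torsionBy.coe_smul]
  exact hf σ P

variable {W m} {f : W.geomPoints →+ W.geomPoints}
  {FT : (W.torsionGaloisModule ((m * m : ℕ) : ℤ)).toContRepresentation →ⁱL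
    (W.torsionGaloisModule ((m * m : ℕ) : ℤ)).toContRepresentation}
  {FS : (W.torsionGaloisModule (m : ℤ)).toContRepresentation →ⁱL (W.torsionGaloisModule (m : ℤ)).toContRepresentation}

/-- `F` commutes with the Galois action (pointwise form). [folklore] -/
private theorem F_smul {n : ℤ}
    {F : (W.torsionGaloisModule n).toContRepresentation →ⁱL (W.torsionGaloisModule n).toContRepresentation}
    (hf : ∀ (σ : absoluteGaloisGroup K) (P : W.geomPoints), f (σ • P) = σ • f P)
    (hF : ∀ S : geomTorsion W n, ((F S : geomTorsion W n) : W.geomPoints) = f S)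
    (σ : absoluteGaloisGroup K) (S : geomTorsion W n) : F (σ • S) = σ • F S :=
  Subtype.ext (by rw [hF, AddSubgroup.torsionBy.coe_smul, AddSubgroup.torsionBy.coe_smul, hF]; exact hf σ S)

/-- `[m] ∘ F_{m²} = F_m ∘ [m]`. [folklore] -/
private theorem mulK_F (hFT : ∀ S, ((FT S : geomTorsion W _) : W.geomPoints) = f S)
    (hFS : ∀ S, ((FS S : geomTorsion W _) : W.geomPoints) = f S) (x : geomTorsion W ((m * m : ℕ) : ℤ)) :
    mulK W m m (FT x) = FS (mulK W m m x) :=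
  Subtype.ext (by rw [coe_mulK_apply, hFT, hFS, coe_mulK_apply, map_zsmul])

/-- `ι ∘ F_m = F_{m²} ∘ ι`. [folklore] -/
private theorem inclKD_F (hFT : ∀ S, ((FT S : geomTorsion W _) : W.geomPoints) = f S)
    (hFS : ∀ S, ((FS S : geomTorsion W _) : W.geomPoints) = f S) (y : geomTorsion W (m : ℤ)) :
    inclKD W m m (FS y) = FT (inclKD W m m y) :=
  Subtype.ext (by rw [coe_inclKD_apply, hFS, hFT, coe_inclKD_apply])

/-- `levelDown ∘ F_{m²} = F_m ∘ levelDown` on `E[m²][m]`. [folklore] -/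
private theorem levelDown_F [CharZero K] (hFT : ∀ S, ((FT S : geomTorsion W _) : W.geomPoints) = f S)
    (hFS : ∀ S, ((FS S : geomTorsion W _) : W.geomPoints) = f S) {x : geomTorsion W ((m * m : ℕ) : ℤ)}
    (hx : mulK W m m x = 0) : levelDown W m (FT x) = FS (levelDown W m x) := by
  apply inclKD_injective W m
  have hx' : mulK W m m (FT x) = 0 := by rw [mulK_F hFT hFS, hx, map_zero]
  rw [inclKD_levelDown W m hx', inclKD_F hFT hFS, inclKD_levelDown W m hx]

variable {e : geomTorsion W ((m * m : ℕ) : ℤ) → geomTorsion W ((m * m : ℕ) : ℤ) → AlgebraicClosure K}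
  {hμ : ∀ S T, e S T ^ (m * m) = 1} {hadd₁ : ∀ S₁ S₂ T, e (S₁ + S₂) T = e S₁ T * e S₂ T}
  {hadd₂ : ∀ S T₁ T₂, e S (T₁ + T₂) = e S T₁ * e S T₂} [CharZero K] [NeZero m]

omit [CharZero K] in
/-- The level-`m²` pairing hom is `F`-invariant when `e` is. [folklore] -/
private theorem weilPairingHom_F (he : ∀ S T, e (FT S) (FT T) = e S T) (S T : geomTorsion W ((m * m : ℕ) : ℤ)) :
    weilPairingHom W (m * m) e hμ hadd₁ hadd₂ (FT S) (FT T) = weilPairingHom W (m * m) e hμ hadd₁ hadd₂ S T := by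
  rw [muCarrier_eq_iff, coe_weilPairingHom, coe_weilPairingHom]
  exact he S T

/-- **The descended pairing `E[m] × E[m] → μ_{m²}` is `F`-invariant**: `desc(F y, F z) = desc(y, z)` (a root
of `F z` is `F` of a root of `z`). [folklore] -/
private theorem descendHom_F (hFT : ∀ S, ((FT S : geomTorsion W _) : W.geomPoints) = f S)
    (hFS : ∀ S, ((FS S : geomTorsion W _) : W.geomPoints) = f S) (he : ∀ S T, e (FT S) (FT T) = e S T)
    (y z : geomTorsion W (m : ℤ)) :
    descendHom W m m e hμ hadd₁ hadd₂ (FS y) (FS z) = descendHom W m m e hμ hadd₁ hadd₂ y z := by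
  rw [descendHom_apply_eq W m m e hμ hadd₁ hadd₂ (FS y) (FS z) (FT (kRoot W m m z))
      (by rw [mulK_F hFT hFS, mulK_kRoot]),
    descendHom_apply_eq W m m e hμ hadd₁ hadd₂ y z (kRoot W m m z) (mulK_kRoot W m m z), inclKD_F hFT hFS,
    weilPairingHom_F he]

/-! ## §2 Functoriality of the local Kummer condition and of Selmer classes in `F` -/

omit [CharZero K] [NeZero m] in
/-- **The local Kummer condition `𝓛_E ≤ H¹(Γ_E, E[n])` is stable under `H¹(F)`** for `F = f|E[n]` with `f`
admitting a local points map `f_E` at `E` (`f_E ∘ ι_* = ι_* ∘ f`): `𝓛_E = ker (H¹(Γ_E, E[n]) → H¹(Γ_E, E(K̄_E)))` and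
`ι_* ∘ F = f_E ∘ ι_*` on `E[n]` (one compatible pair; cf. `resH1Hom_id_mem_selmerLocalKer`). Milne, *ADT*, I.§6 (the
local conditions are functorial). [cite: MilneADT2006, Ch. I §6 Remark 6.10(a) (p. 87)] -/
theorem map_restrictField_mem_kummerLocalConditionAt {n : ℤ}
    {F : (W.torsionGaloisModule n).toContRepresentation →ⁱL (W.torsionGaloisModule n).toContRepresentation}
    (hF : ∀ S : geomTorsion W n, ((F S : geomTorsion W n) : W.geomPoints) = f S)
    (E : Type u) [Field E] [Algebra K E] (fE : localPoints W E →+ localPoints W E)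
    (hfE : ∀ (τ : absoluteGaloisGroup E) (P : localPoints W E), fE (τ • P) = τ • fE P)
    (hcomp : ∀ P : W.geomPoints, fE (pointsMap W E P) = pointsMap W E (f P))
    {c : galoisCohomology (GaloisRep.restrictField E (W.torsionGaloisModule n)) 1}
    (hc : c ∈ W.kummerLocalConditionAt n E) :
    galoisCohomology.map (F.restrictField E) 1 c ∈ W.kummerLocalConditionAt n E := by
  -- the local points map as an intertwining endomorphism of the local module `E(K̄_E)`
  let G : (W.localGaloisModule E).toContRepresentation →ⁱL (W.localGaloisModule E).toContRepresentation :=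
    { toContinuousLinearMap := ⟨fE.toIntLinearMap, continuous_of_discreteTopology⟩
      isIntertwining' := fun τ => by ext P; exact hfE τ P }
  rw [WeierstrassCurve.mem_kummerLocalConditionAt_iff] at hc ⊢
  obtain ⟨ψ, rfl⟩ := oneCocycleClass_surjective _ c
  rw [galoisCohomology.map_one_oneCocycleClass, galoisCohomology.map_one_oneCocycleClass] at *
  have key : galoisCohomology.map G 1 (galoisCohomology.map (W.torsionPointsMapIntertwining n E) 1
      (oneCocycleClass _ ψ)) = 0 := by
    rw [galoisCohomology.map_one_oneCocycleClass, hc, map_zero]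
  rw [galoisCohomology.map_one_oneCocycleClass, galoisCohomology.map_one_oneCocycleClass] at key
  refine Eq.trans (congrArg (oneCocycleClass _) (Subtype.ext (ContinuousMap.ext fun σ => ?_))) key
  change pointsMap W E ((F (ψ.1 σ) : geomTorsion W n) : W.geomPoints) =
    fE (pointsMap W E ((ψ.1 σ : geomTorsion W n) : W.geomPoints))
  rw [hF, hcomp]

omit [CharZero K] [NeZero m] in
/-- `galoisCohomology.map F 1 = resH1Hom (id, F)` on `H¹(K, E[n])` (both are `[β] ↦ [F ∘ β]`). [folklore] -/
private theorem map_one_eq_resH1Hom {n : ℤ}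
    (F : (W.torsionGaloisModule n).toContRepresentation →ⁱL (W.torsionGaloisModule n).toContRepresentation)
    (hFσ : ∀ (σ : absoluteGaloisGroup K) (P : geomTorsion W n),
      F.toContinuousLinearMap.toLinearMap.toAddMonoidHom (ContinuousMonoidHom.id _ σ • P) =
        σ • F.toContinuousLinearMap.toLinearMap.toAddMonoidHom P)
    (c : galoisCohomology (W.torsionGaloisModule n) 1) :
    galoisCohomology.map F 1 c =
      resH1Hom (ContinuousMonoidHom.id _) F.toContinuousLinearMap.toLinearMap.toAddMonoidHom hFσ c := by
  obtain ⟨β, rfl⟩ := oneCocycleClass_surjective _ c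
  rw [galoisCohomology.map_one_oneCocycleClass]
  exact (resH1Hom_id_oneCocycleClass _ hFσ β).symm

/-! ## §3 Transport of Milne's data along `F` -/

variable (hgal : ∀ (σ : absoluteGaloisGroup K) (S T : geomTorsion W ((m * m : ℕ) : ℤ)), σ • e S T = e (σ • S) (σ • T))

/-- The cup product `f ∪_e β'` through the descended pairing is unchanged under `(F ∘ f, F ∘ β')`. [folklore] -/
private theorem cupCocycle₂₁_F (hFT : ∀ S, ((FT S : geomTorsion W _) : W.geomPoints) = f S)
    (hFS : ∀ S, ((FS S : geomTorsion W _) : W.geomPoints) = f S) (he : ∀ S T, e (FT S) (FT T) = e S T)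
    (g : contTwoCocycles (W.torsionGaloisModule (m : ℤ)).toTopRep)
    (β' : contOneCocycles (W.torsionGaloisModule (m : ℤ)).toTopRep) (σ τ υ : absoluteGaloisGroup K) :
    ((descendPairing W m m e hμ hadd₁ hadd₂ hgal).cupCocycle₂₁
        (contTwoCocycles.pullback (ContinuousMonoidHom.id (absoluteGaloisGroup K))
          (X := (W.torsionGaloisModule (m : ℤ)).toTopRep) (Y := (W.torsionGaloisModule (m : ℤ)).toTopRep)
          (TopRep.ofHom ⟨FS.toContinuousLinearMap, FS.isIntertwining'⟩) g)
        (pushOne FS β')).1 (σ, τ, υ) =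
      ((descendPairing W m m e hμ hadd₁ hadd₂ hgal).cupCocycle₂₁ g β').1 (σ, τ, υ) := by
  rw [ContPairing.cupCocycle₂₁_apply, ContPairing.cupCocycle₂₁_apply, descendPairing_toLin_apply, descendPairing_toLin_apply]
  change descendHom W m m e hμ hadd₁ hadd₂ (FS (g.1 (σ, τ))) (FS (β'.1 (σ * τ * υ)) - FS (β'.1 (σ * τ))) = _
  rw [← map_sub, descendHom_F hFT hFS he]

omit [CharZero K] in
/-- Milne's local `2`-cocycle is unchanged when `β_{1,v}, κ_v` are composed with `F_{m²}`, `β'_v` with `F_m`. [folklore] -/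
private theorem cocycle_eq_of_F [NumberField K] {E : Type u} [Field E] [Algebra K E]
    (hFT : ∀ S, ((FT S : geomTorsion W _) : W.geomPoints) = f S)
    (hFS : ∀ S, ((FS S : geomTorsion W _) : W.geomPoints) = f S) (he : ∀ S T, e (FT S) (FT T) = e S T)
    {L L' : GeneralLocalData W m E e hμ hadd₁ hadd₂ hgal} (h₁ : ∀ σ, L'.β₁ σ = FT (L.β₁ σ))
    (hκ : ∀ σ, L'.κ.1 σ = FT (L.κ.1 σ)) (hβ' : ∀ σ, L'.β'.1 σ = FS (L.β'.1 σ)) (hε : L'.ε = L.ε) :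
    L'.cocycle = L.cocycle := by
  refine Subtype.ext (ContinuousMap.ext fun ⟨σ, τ⟩ => ?_)
  rw [GeneralLocalData.cocycle_apply, GeneralLocalData.cocycle_apply, h₁, hκ, hβ', hβ', hε, ← map_sub, ← map_sub,
    levelDown_F hFT hFS (L.mulK_sub σ), descendHom_F hFT hFS he]

omit [CharZero K] in
/-- **Transport of general-case data along an equivariant endomorphism preserving the level-`m²` pairing.** For
`f : E(K̄) → E(K̄)` additive, `Γ_K`-equivariant, with local points maps, and `F = f|E[m²]` with `e (F S) (F T) = e S T`:
Milne's data `(b, β, β₁, f, b', β', ε, κ_v)` for `(a, a')` push forward to `(F b, F∘β, F∘β₁, F∘f, F b', F∘β', ε, F∘κ_v)`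
for `(H¹(f) a, H¹(f) a')` — the SAME `ε` serves because `(F f) ∪_e (F β') = f ∪_e β'` — and every local term is
unchanged («the local pairings are functorial»). [cite: MilneADT2006, Ch. I §6 Remark 6.10(a) (p. 87) and proof of Prop. 6.9] -/
theorem exists_transport [NumberField K] (hf : ∀ (σ : absoluteGaloisGroup K) (P : W.geomPoints), f (σ • P) = σ • f P)
    (hloc : HasLocalPointsMaps W W f) (hFT : ∀ S, ((FT S : geomTorsion W _) : W.geomPoints) = f S)
    (he : ∀ S T, e (FT S) (FT T) = e S T) (D : GeneralCaseData W m e hμ hadd₁ hadd₂ hgal) :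
    ∃ D' : GeneralCaseData W m e hμ hadd₁ hadd₂ hgal,
      torsionH1ToH1 W (m : ℤ) D'.b = galH1Map f hf (torsionH1ToH1 W (m : ℤ) D.b) ∧
      torsionH1ToH1 W (m : ℤ) D'.b' = galH1Map f hf (torsionH1ToH1 W (m : ℤ) D.b') ∧
      ∀ (inv : LocalInvariants K (m * m)) (v : Place K), D'.localTerm inv v = D.localTerm inv v := by
  obtain ⟨FS, hFS⟩ := exists_torsionIntertwining W f hf (m : ℤ)
  have hFSσ : ∀ (σ : absoluteGaloisGroup K) (P : geomTorsion W (m : ℤ)),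
      FS.toContinuousLinearMap.toLinearMap.toAddMonoidHom (ContinuousMonoidHom.id _ σ • P) =
        σ • FS.toContinuousLinearMap.toLinearMap.toAddMonoidHom P := fun σ P => F_smul hf hFS σ P
  let FTc : C(geomTorsion W ((m * m : ℕ) : ℤ), geomTorsion W ((m * m : ℕ) : ℤ)) := ⟨FT, continuous_of_discreteTopology⟩
  let D' : GeneralCaseData W m e hμ hadd₁ hadd₂ hgal :=
          { b := resH1Hom (ContinuousMonoidHom.id _) FS.toContinuousLinearMap.toLinearMap.toAddMonoidHom hFSσ D.b
            b_mem := resH1Hom_id_mem_selmerGroup (m : ℤ) _ hFSσ f hFS hloc D.b_mem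
            β := pushOne FS D.β
            hβ := by rw [oneCocycleClass_pushOne, D.hβ, map_one_eq_resH1Hom]
            β₁ := FTc.comp D.β₁
            mulK_β₁ := fun σ => by change mulK W m m (FT (D.β₁ σ)) = FS (D.β.1 σ); rw [mulK_F hFT hFS, D.mulK_β₁]
            f := contTwoCocycles.pullback (ContinuousMonoidHom.id (absoluteGaloisGroup K))
              (X := (W.torsionGaloisModule (m : ℤ)).toTopRep) (Y := (W.torsionGaloisModule (m : ℤ)).toTopRep)
              (TopRep.ofHom ⟨FS.toContinuousLinearMap, FS.isIntertwining'⟩) D.f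
            inclKD_f := fun σ τ => by
              change inclKD W m m (FS (D.f.1 (σ, τ))) = σ • FT (D.β₁ τ) - FT (D.β₁ (σ * τ)) + FT (D.β₁ σ)
              rw [inclKD_F hFT hFS, D.inclKD_f, map_add, map_sub, F_smul hf hFT]
            b' := resH1Hom (ContinuousMonoidHom.id _) FS.toContinuousLinearMap.toLinearMap.toAddMonoidHom hFSσ D.b'
            b'_mem := resH1Hom_id_mem_selmerGroup (m : ℤ) _ hFSσ f hFS hloc D.b'_mem
            β' := pushOne FS D.β'
            hβ' := by rw [oneCocycleClass_pushOne, D.hβ', map_one_eq_resH1Hom]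
            ε := D.ε
            dTwo_ε := fun σ τ υ => by rw [← D.dTwo_ε σ τ υ]; exact cupCocycle₂₁_F hgal hFT hFS he D.f D.β' σ τ υ
            κ := fun v => pushOne (FT.restrictField (Place.Completion v)) (D.κ v)
            κ_mem := fun v => by
              obtain ⟨fE, hfE, hcomp⟩ := hloc (Place.Completion v)
              rw [locClass_eq, oneCocycleClass_pushOne]
              exact map_restrictField_mem_kummerLocalConditionAt hFT _ fE hfE hcomp (D.κ_mem v)
            mulK_κ := fun v σ => by
              change mulK W m m (FT ((D.κ v).1 σ)) = mulK W m m (FT (D.β₁ (absGaloisRestrict K (Place.Completion v) σ)))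
              rw [mulK_F hFT hFS, mulK_F hFT hFS, D.mulK_κ] }
  refine ⟨D', torsionH1ToH1_resH1Hom_id (m : ℤ) _ hFSσ f hf hFS D.b,
    torsionH1ToH1_resH1Hom_id (m : ℤ) _ hFSσ f hf hFS D.b', fun inv v => ?_⟩
  -- the local `2`-cocycles agree pointwise
  change GeneralLocalData.term (D'.localData v) (inv v) = GeneralLocalData.term (D.localData v) (inv v)
  unfold GeneralLocalData.term
  rw [cocycle_eq_of_F hgal hFT hFS he (L := D.localData v) (L' := D'.localData v) (fun σ => rfl) (fun σ => rfl)
    (fun σ => rfl) rfl]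

end CasselsTateInvariance

/-! ## §4 Invariance of `ctGeneralFun` under a `K`-automorphism preserving `e`; adjointness; `𝒪`-balance -/

section Invariance

variable {K : Type u} [Field K] [NumberField K] (V : WeierstrassCurve K) [V.IsElliptic] (m : ℕ) [NeZero m]
variable (e : geomTorsion V ((m * m : ℕ) : ℤ) → geomTorsion V ((m * m : ℕ) : ℤ) → AlgebraicClosure K)
  (hμ : ∀ S T, e S T ^ (m * m) = 1) (hadd₁ : ∀ S₁ S₂ T, e (S₁ + S₂) T = e S₁ T * e S₂ T)
  (hadd₂ : ∀ S T₁ T₂, e S (T₁ + T₂) = e S T₁ * e S T₂)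
  (hgal : ∀ (σ : absoluteGaloisGroup K) (S T : geomTorsion V ((m * m : ℕ) : ℤ)), σ • e S T = e (σ • S) (σ • T))
  (inv : LocalInvariants K (m * m))

/-- **Invariance of the general-case Cassels–Tate function under a `K`-automorphism of the curve preserving the
level-`m²` pairing**: for `Γ_K`-equivariant additive `f, g : E(K̄) → E(K̄)` inverse to each other, with local points
maps, and `e (f S) (f T) = e S T` on `E[m²]`: `⟨H¹(f) a, H¹(f) a'⟩ = ⟨a, a'⟩` for ALL `a, a' ∈ H¹(K, E)` and every
family `inv` with the reciprocity law (transport of Milne's data in both directions; Milne I Rem. 6.10(a) for an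
automorphism, `fᵗ = f⁻¹`). [cite: MilneADT2006, Ch. I §6 Remark 6.10(a) (p. 87)] [cite: SilvermanAEC2009, Thm. III.6.1] -/
theorem ctGeneralFun_galH1Map_galH1Map_of_inverse (f g : V.geomPoints →+ V.geomPoints)
    (hf : ∀ (σ : absoluteGaloisGroup K) (P : V.geomPoints), f (σ • P) = σ • f P)
    (hg : ∀ (σ : absoluteGaloisGroup K) (P : V.geomPoints), g (σ • P) = σ • g P)
    (hgf : ∀ P, g (f P) = P) (hfg : ∀ P, f (g P) = P)
    (hlocf : HasLocalPointsMaps V V f) (hlocg : HasLocalPointsMaps V V g)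
    (he : ∀ (S T S' T' : geomTorsion V ((m * m : ℕ) : ℤ)),
      (S' : V.geomPoints) = f S → (T' : V.geomPoints) = f T → e S' T' = e S T)
    (halt : ∀ T, e T T = 1) (hPT' : inv.SumInvLocalizationEqZero) (a a' : V.galH1) :
    ctGeneralFun V m e hμ hadd₁ hadd₂ hgal inv (galH1Map f hf a) (galH1Map f hf a') =
      ctGeneralFun V m e hμ hadd₁ hadd₂ hgal inv a a' := by
  obtain ⟨FT, hFT⟩ := CasselsTateInvariance.exists_torsionIntertwining V f hf ((m * m : ℕ) : ℤ)
  obtain ⟨GT, hGT⟩ := CasselsTateInvariance.exists_torsionIntertwining V g hg ((m * m : ℕ) : ℤ)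
  have heF : ∀ S T, e (FT S) (FT T) = e S T := fun S T => he S T _ _ (hFT S) (hFT T)
  have heG : ∀ S T, e (GT S) (GT T) = e S T := fun S T =>
    (he (GT S) (GT T) S T (by rw [hGT, hfg]) (by rw [hGT, hfg])).symm
  have hga : ∀ c : V.galH1, galH1Map g hg (galH1Map f hf c) = c := fun c => by
    rw [galH1Map_galH1Map_of_comp_eq_nsmul f hf g hg (n := 1) (fun P => by rw [hgf, Nat.cast_one, one_zsmul]) c,
      one_nsmul]
  by_cases h : ∃ D : GeneralCaseData V m e hμ hadd₁ hadd₂ hgal, torsionH1ToH1 V (m : ℤ) D.b = a ∧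
      torsionH1ToH1 V (m : ℤ) D.b' = a' ∧ ∃ S : Finset (Place K), ∀ v ∉ S, D.localTerm inv v = 0
  · obtain ⟨D, hb, hb', S, hS⟩ := h
    obtain ⟨D', hD'b, hD'b', hloc'⟩ := CasselsTateInvariance.exists_transport hgal hf hlocf hFT heF D
    have hS' : ∀ v ∉ S, D'.localTerm inv v = 0 := fun v hv => by rw [hloc', hS v hv]
    rw [← hb, ← hb', ← hD'b, ← hD'b', ctGeneralFun_eq inv halt hPT' D' hS', ctGeneralFun_eq inv halt hPT' D hS]
    exact Finset.sum_congr rfl fun v _ => hloc' inv v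
  · rw [ctGeneralFun_eq_zero_of_not inv h]
    refine ctGeneralFun_eq_zero_of_not inv fun ⟨D', hb, hb', S, hS⟩ => h ?_
    obtain ⟨D'', h1, h2, hloc''⟩ := CasselsTateInvariance.exists_transport hgal hg hlocg hGT heG D'
    exact ⟨D'', by rw [h1, hb, hga], by rw [h2, hb', hga], S, fun v hv => by rw [hloc'', hS v hv]⟩

/-- **Invariance, isogeny form**: for isogenies `φ, ψ : E → E` over `K` inverse to each other (e.g. `[ζ]`, `[ζ²]` on
a `j = 0` curve) with `e (φ S) (φ T) = e S T` on `E[m²]`: `⟨H¹(φ) a, H¹(φ) a'⟩ = ⟨a, a'⟩`.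
[cite: MilneADT2006, Ch. I §6 Remark 6.10(a) (p. 87)] [cite: SilvermanAEC2009, Thm. III.6.1] -/
theorem ctGeneralFun_galH1Map_galH1Map_of_isogeny_inverse (φ ψ : Isogeny V V) (hψφ : ∀ P, ψ (φ P) = P)
    (hφψ : ∀ P, φ (ψ P) = P)
    (he : ∀ (S T S' T' : geomTorsion V ((m * m : ℕ) : ℤ)),
      (S' : V.geomPoints) = φ S → (T' : V.geomPoints) = φ T → e S' T' = e S T)
    (halt : ∀ T, e T T = 1) (hPT' : inv.SumInvLocalizationEqZero) (a a' : V.galH1) :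
    ctGeneralFun V m e hμ hadd₁ hadd₂ hgal inv (galH1Map φ.toAddMonoidHom φ.equivariant a)
        (galH1Map φ.toAddMonoidHom φ.equivariant a') =
      ctGeneralFun V m e hμ hadd₁ hadd₂ hgal inv a a' :=
  ctGeneralFun_galH1Map_galH1Map_of_inverse V m e hμ hadd₁ hadd₂ hgal inv φ.toAddMonoidHom ψ.toAddMonoidHom
    φ.equivariant ψ.equivariant hψφ hφψ φ.hasLocalPointsMaps_toAddMonoidHom ψ.hasLocalPointsMaps_toAddMonoidHom he
    halt hPT' a a'

/-- **Milne's Remark I.6.10(a) for an automorphism, in the shape of clause (vi) of `casselsTate_canonical_adjoint`**: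
for isogenies `φ, ψ : E → E` over `K` inverse to each other (`ψ = φ̂`, `deg φ = 1`) with `e (φ S) (φ T) = e S T` on
`E[m²]`: `⟨H¹(φ) a, b⟩ = ⟨a, H¹(ψ) b⟩` for ALL `a, b ∈ H¹(K, E)` and every `inv` with the reciprocity law (in
particular THE canonical one). [cite: MilneADT2006, Ch. I §6 Remark 6.10(a) (p. 87)] [cite: SilvermanAEC2009, Thm. III.6.1] -/
theorem ctGeneralFun_galH1Map_left_eq_galH1Map_right_of_isogeny_inverse (φ ψ : Isogeny V V)
    (hψφ : ∀ P, ψ (φ P) = P) (hφψ : ∀ P, φ (ψ P) = P)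
    (he : ∀ (S T S' T' : geomTorsion V ((m * m : ℕ) : ℤ)),
      (S' : V.geomPoints) = φ S → (T' : V.geomPoints) = φ T → e S' T' = e S T)
    (halt : ∀ T, e T T = 1) (hPT' : inv.SumInvLocalizationEqZero) (a b : V.galH1) :
    ctGeneralFun V m e hμ hadd₁ hadd₂ hgal inv (galH1Map φ.toAddMonoidHom φ.equivariant a) b =
      ctGeneralFun V m e hμ hadd₁ hadd₂ hgal inv a (galH1Map ψ.toAddMonoidHom ψ.equivariant b) := by
  have hb : galH1Map φ.toAddMonoidHom φ.equivariant (galH1Map ψ.toAddMonoidHom ψ.equivariant b) = b := by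
    rw [galH1Map_galH1Map_of_comp_eq_nsmul ψ.toAddMonoidHom ψ.equivariant φ.toAddMonoidHom φ.equivariant (n := 1)
      (fun P => by rw [Nat.cast_one, one_zsmul]; exact hφψ P) b, one_nsmul]
  conv_lhs => rw [← hb]
  exact ctGeneralFun_galH1Map_galH1Map_of_isogeny_inverse V m e hμ hadd₁ hadd₂ hgal inv φ ψ hψφ hφψ he halt hPT' a _

/-- **`𝒪`-balance from invariance.** For an isogeny `φ : E → E` over `K` with `φ³ = id` (e.g. `[ζ]` on a `j = 0`
curve) preserving the level-`m²` pairing `e`, a pairing `B₂` on a subgroup `M ≤ Ш(E/K)` factoring through the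
general-case Cassels–Tate function (`B₂ a b = t ⟨a, b⟩`) is INVARIANT under any additive `w : M → M` lying under
`Ш(φ)`, hence — when `w² + w + 1 = 0`, so `w³ = 1` — `𝒪 = ℤ[w]`-BALANCED: `B₂ (w a) b = B₂ a (w² b) = B₂ a (-b - w b)`
(the sesquilinearity input of McCallum 1991 §5, from Milne I Rem. 6.10(a) for `[ζ]`, `[ζ]ᵗ = [ζ²]`).
[cite: MilneADT2006, Ch. I §6 Remark 6.10(a) (p. 87)] [cite: McCallumLMS1991, §5] -/
theorem pairing_omegaBalanced_of_weilInvariant (φ : Isogeny V V) (hφ3 : ∀ P, φ (φ (φ P)) = P)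
    (he : ∀ (S T S' T' : geomTorsion V ((m * m : ℕ) : ℤ)),
      (S' : V.geomPoints) = φ S → (T' : V.geomPoints) = φ T → e S' T' = e S T)
    (halt : ∀ T, e T T = 1) (hPT' : inv.SumInvLocalizationEqZero) {Q : Type*} [AddCommGroup Q]
    (t : ZMod (m * m) →+ Q) {M : AddSubgroup V.sha} (B₂ : M →+ M →+ Q)
    (hB₂ : ∀ a b, B₂ a b = t (ctGeneralFun V m e hμ hadd₁ hadd₂ hgal inv ((a : V.sha) : V.galH1) ((b : V.sha) : V.galH1)))
    (w : M →+ M)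
    (hw : ∀ x, ((w x : M) : V.sha) = shaMap φ.toAddMonoidHom φ.equivariant φ.hasLocalPointsMaps_toAddMonoidHom x)
    (hwrel : ∀ x, w (w x) + w x + x = 0) (a b : M) :
    B₂ (w a) (w b) = B₂ a b ∧ B₂ (w a) b = B₂ a (w (w b)) ∧ B₂ (w a) b = B₂ a (-b - w b) := by
  -- `φ² = φ⁻¹` as an equivariant additive map with local points maps
  have hinv : ∀ x y : M, B₂ (w x) (w y) = B₂ x y := fun x y => by
    rw [hB₂, hB₂, hw, hw, coe_shaMap_apply, coe_shaMap_apply]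
    exact congrArg t (ctGeneralFun_galH1Map_galH1Map_of_inverse V m e hμ hadd₁ hadd₂ hgal inv φ.toAddMonoidHom
      (φ.toAddMonoidHom.comp φ.toAddMonoidHom) φ.equivariant
      (fun σ P => by rw [AddMonoidHom.comp_apply, AddMonoidHom.comp_apply, φ.equivariant, φ.equivariant])
      (fun P => hφ3 P) (fun P => hφ3 P) φ.hasLocalPointsMaps_toAddMonoidHom
      (φ.hasLocalPointsMaps_toAddMonoidHom.comp φ.hasLocalPointsMaps_toAddMonoidHom) he halt hPT' _ _)
  have h3 : ∀ x : M, w (w (w x)) = x := fun x => by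
    have h1 := hwrel (w x)
    have h2 := hwrel x
    calc w (w (w x)) = (w (w (w x)) + w (w x) + w x) - (w (w x) + w x + x) + x := by abel
      _ = x := by rw [h1, h2, sub_self, zero_add]
  have hww : w (w b) = -b - w b := by
    have h2 := hwrel b
    calc w (w b) = (w (w b) + w b + b) - b - w b := by abel
      _ = -b - w b := by rw [h2, zero_sub]
  have hbal : B₂ (w a) b = B₂ a (w (w b)) := by
    conv_lhs => rw [← h3 b]
    exact hinv a (w (w b))
  exact ⟨hinv a b, hbal, hww ▸ hbal⟩

end Invariance

end Literature.NumberTheory.EllipticCurves
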